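/-
Copyright (c) 2026 the pub-hodgecm-mathlib formalisation cell (harness21).  Prover seat hodgecm-mathlib-K2Liu-p10 (g5), Track B «K2-LIT»,
#184♮ = hLiu418 = `stmt-HodgeConjecture-24832`; (σ) endgame organ, socket σ-6: the residual BY-VALUE sockets `K₁ hK₁ hχeq hχu hχu′` of ★ σ-3∕σ-4
`hK₁χ_of_laws` (and of 📤 I-4b v3 `faceA4R_two_of_record`), DISCHARGED.
-/
import Summits.HodgeConjecture.HodgeConjecture.Theorems.K2LiuA7ValueSocketChi                     -- ★ σ-1 p860889 (`conjInvChar`, `conjInvChar_apply`, `conjInvChar_eq`)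
import Summits.HodgeConjecture.HodgeConjecture.Theorems.K2LiuA7ValueInstanceTopology              -- ★ I-4c (`isClosedEmbedding_subtype_leviDeltaLoc`; brings ★ I-2 `leviDeltaLoc`)
import Literature.NumberTheory.GelbartRogawski1991.LocalDoubledUnitaryDatum                         -- ★ `chiDet`
import Literature.NumberTheory.GaloisRepresentations.HeckeCharacterGaloisConjLocalComponent        -- ★ `HeckeCharacter.localComponent_galConj_apply`
import Literature.NumberTheory.GaloisRepresentations.HeckeCharacterConjugateDualOfQuadraticCM      -- ★ `HeckeCharacter.galConj_eq_inv_of_restrict_eq_quadraticHeckeCharCM`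
import Literature.RepresentationTheory.HarrisKudlaSweet1996.GlobalSplittingCharacters              -- ★ `IsSplittingChar`, `isSplittingChar_iff_of_odd`
import Literature.NumberTheory.Automorphic.UnitaryGroupLocalFactors                                 -- ★ `UnitaryGroup.localInt`, `isCompact_localInt`, `isOpen_localInt`
import HarnessLib

/-!
# Crux `HLiu418`, (σ) endgame, socket σ-6: THE RESIDUAL SOCKETS `K₁ hK₁ hχeq hχu hχu′` OF `hK₁χ_of_laws` ∕ OF THE FACE, DISCHARGED

Cell `hodgecm-mathlib`, crux item hLiu418 = `stmt-HodgeConjecture-24832`, route of record `HCCMUnconditional`; squad K2 ∕ K2Liu, prover K2Liu-p10 (g5).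
THEOREMS ONLY (no definition, no instance, no notation, no named fact, no `sorry`); lane `--supports stmt-HodgeConjecture-24832 --as helper`.

★ σ-3∕σ-4 `K2LiuA7ValueSocketLevi.hK₁χ_of_laws` (p860908) reduces V8e's socket `hK₁χ` to: a compact `K₁ ≤ Γ₁ = ↥M_Δ`, unitarity `hχu hχu′` of the two local
character families `χ_v, χ′_v`, and `hχeq : chiDet χ′_v = chiDet χ_v` on `mΔ(K₁)`; the assembler's v3 face (K2Liu-p09 (g7) 14:35:45Z) keeps `K₁ hK₁ hχeq` BY VALUE.
This file supplies them at the instance of record, where `χ_v := fun w => (χ ^ 3).localComponent w.1` and `χ′_v := conjInvChar c v χ_v` (★ σ-1):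

* §1 (generic `(F E c v)`, any Hecke character `μ` of `E`) — CONJUGATE SELF-DUALITY READ LOCALLY: under the guard `hdual : galConj c μ = μ⁻¹`
  (★ `HeckeCharacter.galConj`), **`conjInvChar c v (fun w => μ.localComponent w.1) = fun w => μ.localComponent w.1`** (`conjInvChar_localComponent_of_galConj_eq_inv`:
  `(μ_{c w})⁻¹ ∘ gal_{w → c w} = ((μ ∘ c)_w)⁻¹ = ((μ⁻¹)_w)⁻¹ = μ_w`, ★ `HeckeCharacter.localComponent_galConj_apply`); hence V8e's `hχ′` holds with `χ′_v := χ_v`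
  (`localComponent_eq_inv_comp_gal_of_galConj_eq_inv`), `chiDet χ′_v = chiDet χ_v` EVERYWHERE (`chiDet_conjInvChar_of_galConj_eq_inv`), and unitarity passes to
  `conjInvChar` (`norm_conjInvChar_eq_one`) and to powers (`norm_localComponent_pow_eq_one`); `galConj_pow`.
* §2 (CM: `L`, `χ` with `hχs : IsSplittingChar L 1 χ`, ★ HKS (1.5)) — the guard holds for every power: **`galConj c (χ ^ k) = (χ ^ k)⁻¹`**
  (`galConj_complexConj_pow_eq_inv`; ★ `HeckeCharacter.galConj_eq_inv_of_restrict_eq_quadraticHeckeCharCM` = Rogawski's `μ ∘ c = μ⁻¹` for `μ| = ω_{L∕L⁺}`), so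
  **`conjInvChar_localComponent_pow_eq`** (`χ′_v = χ_v` LITERALLY at the instance `μ := χ ^ k`, in particular `k = 3`) and the socket
  **`hχeq_of_isSplittingChar : ∀ h, chiDet χ′_v h = chiDet χ_v h`** (any `K₁`); `hχu_of_isUnitary`, `hχu'_of_isUnitary` from `χ.IsUnitary`.
* §3 (CM datum `(L, e, dV, dW)`, ★ I-2 `leviDeltaLoc`) — **`K₁ := U(𝔻)(𝒪_v) ∩ M_Δ`**, i.e. `(UnitaryGroup.localInt …).comap M_Δ.subtype`, is COMPACT AND OPEN in `↥M_Δ`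
  (`isCompact_isOpen_comap_localInt_leviDeltaLoc`: ★ `isCompact_localInt`∕`isOpen_localInt` + ★ I-4c `isClosedEmbedding_subtype_leviDeltaLoc`); generally for any
  compact-open `K₀ ≤ H_v` (`isCompact_isOpen_comap_leviDeltaLoc`); `exists_isCompact_isOpen_leviDeltaLoc`.

HONEST LABEL: HC_CM is proved only modulo the 7 printed citations (2 remaining named inputs: hLiu418 = stmt-HodgeConjecture-24832, h413 = stmt-HodgeConjecture-24833)
until rung 0 closes; helper, closes no item.
References: [Liu2021] App. B §B.3 (`μᶜ`), Def. 4.1; [Rogawski1990] §4.9 p. 54 (`μ|_{I_F} = ω_{E∕F}` ⇒ `μ(ȳ) = μ(y)⁻¹`); [TateThesis1967] §4.3 (local components);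
[CasselsFrohlichANT1967] Ch. VII §1.1; [HarrisKudlaSweet1996] §1 (1.5), (1.15); [PlatonovRapinchuk1994] §5.1 (`U(J)(𝒪_v)` compact open).
-/

set_option autoImplicit false
set_option linter.dupNamespace false -- the mandated namespace repeats `HodgeConjecture.HodgeConjecture`

noncomputable section

open scoped Matrix
open NumberField IsDedekindDomain Topology
open Literature.NumberTheory.GaloisRepresentations
open Literature.NumberTheory.Automorphic Literature.NumberTheory.Automorphic.UnitaryGroup
open Literature.NumberTheory.GelbartRogawski1991 Literature.NumberTheory.GelbartRogawski1991.GRConstruction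
open Literature.NumberTheory.GelbartRogawski1991.UnitaryDualPair
open Literature.NumberTheory.GelbartRogawski1991.UnitaryDualPair.LocalSplitting
open Literature.RepresentationTheory.HarrisKudlaSweet1996
open Summit.HodgeConjecture.HodgeConjecture.Cruxes.HLiu418.K2LiuA7ValueSocketChi
open Summit.HodgeConjecture.HodgeConjecture.Cruxes.HLiu418.K2LiuA7ValueInstanceDefs
open Summit.HodgeConjecture.HodgeConjecture.Cruxes.HLiu418.K2LiuA7ValueInstanceTopology

namespace Summit.HodgeConjecture.HodgeConjecture.Cruxes.HLiu418.K2LiuA7ValueSocketLeviResidue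

/-! ## §1 Conjugate self-duality read on the local components (generic `(F E c v)`) -/

section Generic

variable {F : Type} [Field F] [NumberField F] (E : Type) [Field E] [NumberField E] [Algebra F E] (c : E ≃ₐ[F] E)
  (v : HeightOneSpectrum (𝓞 F))

omit [NumberField F] in
/-- `galConj` commutes with powers: `(μ ^ k) ∘ σ = (μ ∘ σ) ^ k`. [folklore] -/
theorem galConj_pow (σ : E ≃ₐ[F] E) (μ : HeckeCharacter E) (k : ℕ) :
    HeckeCharacter.galConj σ (μ ^ k) = HeckeCharacter.galConj σ μ ^ k :=
  HeckeCharacter.ext fun x => by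
    rw [HeckeCharacter.galConj_apply, HeckeCharacter.pow_apply, HeckeCharacter.pow_apply, HeckeCharacter.galConj_apply]

/-- **`χ′_v = χ_v` FOR A CONJUGATE SELF-DUAL `μ`**: under `μ ∘ c = μ⁻¹`, the conjugate-inverse family of the local components of `μ` at the places over `v`
IS the family of local components: `(μ_{c w})⁻¹(gal_{w → c w} u) = ((μ ∘ c)_w (u))⁻¹ = ((μ⁻¹)_w (u))⁻¹ = μ_w(u)`.
[cite: Liu2021, App. B §B.3; Def. 4.1] [cite: TateThesis1967, §4.3] [cite: CasselsFrohlichANT1967, Ch. VII §1.1] -/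
theorem conjInvChar_localComponent_of_galConj_eq_inv (μ : HeckeCharacter E) (hdual : HeckeCharacter.galConj c μ = μ⁻¹) :
    conjInvChar E c v (fun w : PlacesOver E v => μ.localComponent w.1) = fun w : PlacesOver E v => μ.localComponent w.1 := by
  funext w
  ext u : 1
  rw [conjInvChar_apply]
  have h := HeckeCharacter.localComponent_galConj_apply c μ (rfl : c • w.1 = c • w.1) u
  rw [hdual] at h
  change (μ.localComponent (c • w.1) (Units.map (galAdicCompletionMap (L := E) c (rfl : c • w.1 = c • w.1) :
      w.1.adicCompletion E →* (c • w.1).adicCompletion E) u))⁻¹ = μ.localComponent w.1 u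
  rw [← h, HeckeCharacter.localComponent_apply, HeckeCharacter.localComponent_apply, HeckeCharacter.inv_apply, inv_inv]

/-- **V8e's `hχ′` WITH `χ′_v := χ_v`** for a conjugate self-dual `μ`: `μ_w = (μ_{w′})⁻¹ ∘ gal_{w → w′}` whenever `c • w = w′` (★ σ-1 `conjInvChar_eq`).
[cite: Liu2021, App. B §B.3; Def. 4.1] [cite: TateThesis1967, §4.3] -/
theorem localComponent_eq_inv_comp_gal_of_galConj_eq_inv (μ : HeckeCharacter E) (hdual : HeckeCharacter.galConj c μ = μ⁻¹)
    (w w' : PlacesOver E v) (h : c • w.1 = w'.1) :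
    (fun w : PlacesOver E v => μ.localComponent w.1) w =
      ((fun w : PlacesOver E v => μ.localComponent w.1) w')⁻¹.comp
        (Units.map (galAdicCompletionMap (L := E) c h : w.1.adicCompletion E →* w'.1.adicCompletion E)) := by
  rw [← conjInvChar_eq E c v (fun w : PlacesOver E v => μ.localComponent w.1) w w' h,
    conjInvChar_localComponent_of_galConj_eq_inv E c v μ hdual]

/-- unitarity passes to the conjugate-inverse family: `‖χ′_w(u)‖ = ‖χ_{c w}(gal u)‖⁻¹ = 1`. [cite: HarrisKudlaSweet1996, §1 (1.15)] -/
theorem norm_conjInvChar_eq_one (χv : ∀ w : PlacesOver E v, (w.1.adicCompletion E)ˣ →* ℂˣ)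
    (hχu : ∀ (w : PlacesOver E v) (u : (w.1.adicCompletion E)ˣ), ‖((χv w u : ℂˣ) : ℂ)‖ = 1)
    (w : PlacesOver E v) (u : (w.1.adicCompletion E)ˣ) : ‖((conjInvChar E c v χv w u : ℂˣ) : ℂ)‖ = 1 := by
  rw [conjInvChar_apply, Units.val_inv_eq_inv_val, norm_inv, hχu, inv_one]

/-- the local components of a unitary Hecke character are unitary. [cite: TateThesis1967, §4.3] -/
theorem norm_localComponent_eq_one (μ : HeckeCharacter E) (hμu : μ.IsUnitary) (w : HeightOneSpectrum (𝓞 E)) (u : (w.adicCompletion E)ˣ) :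
    ‖((μ.localComponent w u : ℂˣ) : ℂ)‖ = 1 := by
  rw [HeckeCharacter.localComponent_apply]
  exact hμu _

/-- … and so are those of its powers. [cite: TateThesis1967, §4.3] -/
theorem norm_localComponent_pow_eq_one (μ : HeckeCharacter E) (hμu : μ.IsUnitary) (k : ℕ) (w : HeightOneSpectrum (𝓞 E)) (u : (w.adicCompletion E)ˣ) :
    ‖(((μ ^ k).localComponent w u : ℂˣ) : ℂ)‖ = 1 := by
  rw [HeckeCharacter.localComponent_apply, HeckeCharacter.pow_apply, Units.val_pow_eq_pow_val, norm_pow, hμu, one_pow]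

/-- **`chiDet χ′_v = chiDet χ_v` EVERYWHERE** for a conjugate self-dual `μ` (the socket `hχeq`, with no restriction to `K₁`). [cite: HarrisKudlaSweet1996, §1 (1.15)] -/
theorem chiDet_conjInvChar_of_galConj_eq_inv (n : ℕ) {JD : Matrix (Fin (n + n)) (Fin (n + n)) E} (μ : HeckeCharacter E)
    (hdual : HeckeCharacter.galConj c μ = μ⁻¹) (h : UnitaryGroup.localPi E c (n + n) JD v) :
    chiDet F E c v n (conjInvChar E c v fun w : PlacesOver E v => μ.localComponent w.1) h =
      chiDet F E c v n (fun w : PlacesOver E v => μ.localComponent w.1) h := by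
  rw [conjInvChar_localComponent_of_galConj_eq_inv E c v μ hdual]

end Generic

/-! ## §2 The CM instance: `χ` a splitting character (`χ|_{𝕀_{L⁺}} = ε_{L∕L⁺}`), `μ := χ ^ k` -/

section CM

variable (L : Type) [Field L] [NumberField L] [IsCMField L] {χ : HeckeCharacter L}

/-- a splitting character of odd weight `m` is conjugate self-dual: `χ ∘ c = χ⁻¹` (★ Rogawski's «hdual-of-ω» from HKS (1.5)).
[cite: Rogawski1990, §4.9 p. 54] [cite: HarrisKudlaSweet1996, §1 (1.5)] -/
theorem galConj_complexConj_eq_inv_of_isSplittingChar {m : ℕ} (hm : Odd m) (hχ : IsSplittingChar L m χ) :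
    HeckeCharacter.galConj (IsCMField.complexConj L) χ = χ⁻¹ :=
  HeckeCharacter.galConj_eq_inv_of_restrict_eq_quadraticHeckeCharCM L χ ((isSplittingChar_iff_of_odd hm χ).1 hχ)

/-- **every power of a splitting character `χ| = ε` is conjugate self-dual**: `(χ ^ k) ∘ c = (χ ^ k)⁻¹`.
[cite: Rogawski1990, §4.9 p. 54] [cite: HarrisKudlaSweet1996, §1 (1.5)] -/
theorem galConj_complexConj_pow_eq_inv (hχs : IsSplittingChar L 1 χ) (k : ℕ) :
    HeckeCharacter.galConj (IsCMField.complexConj L) (χ ^ k) = (χ ^ k)⁻¹ := by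
  rw [galConj_pow, galConj_complexConj_eq_inv_of_isSplittingChar L odd_one hχs, inv_pow]

/-- **`χ′_v = χ_v` AT THE INSTANCE `μ := χ ^ k`** (the face takes `k = 3`): the conjugate-inverse family of `w ↦ (χ^k)_w` is `w ↦ (χ^k)_w` itself.
[cite: Liu2021, App. B §B.3; Def. 4.1] [cite: Rogawski1990, §4.9 p. 54] -/
theorem conjInvChar_localComponent_pow_eq (hχs : IsSplittingChar L 1 χ) (k : ℕ) (v : HeightOneSpectrum (𝓞 (Fp L))) :
    conjInvChar L (IsCMField.complexConj L) v (fun w : PlacesOver L v => (χ ^ k).localComponent w.1) =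
      fun w : PlacesOver L v => (χ ^ k).localComponent w.1 :=
  conjInvChar_localComponent_of_galConj_eq_inv L (IsCMField.complexConj L) v (χ ^ k) (galConj_complexConj_pow_eq_inv L hχs k)

/-- V8e's `hχ′` with `χ′_v := χ_v := fun w => (χ^k)_w`. [cite: Liu2021, App. B §B.3; Def. 4.1] -/
theorem localComponent_pow_eq_inv_comp_gal (hχs : IsSplittingChar L 1 χ) (k : ℕ) (v : HeightOneSpectrum (𝓞 (Fp L)))
    (w w' : PlacesOver L v) (h : IsCMField.complexConj L • w.1 = w'.1) :
    (fun w : PlacesOver L v => (χ ^ k).localComponent w.1) w =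
      ((fun w : PlacesOver L v => (χ ^ k).localComponent w.1) w')⁻¹.comp
        (Units.map (galAdicCompletionMap (L := L) (IsCMField.complexConj L) h : w.1.adicCompletion L →* w'.1.adicCompletion L)) :=
  localComponent_eq_inv_comp_gal_of_galConj_eq_inv L (IsCMField.complexConj L) v (χ ^ k) (galConj_complexConj_pow_eq_inv L hχs k) w w' h

/-- **THE SOCKET `hχeq` (any `K₁`, indeed any `h`)**: `chiDet χ′_v h = chiDet χ_v h` for `χ_v := fun w => (χ^k)_w`, `χ′_v := conjInvChar c v χ_v`.
[cite: HarrisKudlaSweet1996, §1 (1.15)] [cite: Rogawski1990, §4.9 p. 54] -/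
theorem hχeq_of_isSplittingChar (hχs : IsSplittingChar L 1 χ) (k : ℕ) (v : HeightOneSpectrum (𝓞 (Fp L))) (n : ℕ)
    {JD : Matrix (Fin (n + n)) (Fin (n + n)) L} (h : UnitaryGroup.localPi L (IsCMField.complexConj L) (n + n) JD v) :
    chiDet (Fp L) L (IsCMField.complexConj L) v n
        (conjInvChar L (IsCMField.complexConj L) v fun w : PlacesOver L v => (χ ^ k).localComponent w.1) h =
      chiDet (Fp L) L (IsCMField.complexConj L) v n (fun w : PlacesOver L v => (χ ^ k).localComponent w.1) h := by
  rw [conjInvChar_localComponent_pow_eq L hχs k v]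

omit [IsCMField L] in
/-- **THE SOCKET `hχu`**: `‖(χ^k)_w(u)‖ = 1` for a unitary `χ`. [cite: TateThesis1967, §4.3] [cite: HarrisKudlaSweet1996, §1 (1.15)] -/
theorem hχu_of_isUnitary (hχu : χ.IsUnitary) (k : ℕ) (v : HeightOneSpectrum (𝓞 (Fp L))) (w : PlacesOver L v) (u : (w.1.adicCompletion L)ˣ) :
    ‖(((fun w : PlacesOver L v => (χ ^ k).localComponent w.1) w u : ℂˣ) : ℂ)‖ = 1 :=
  norm_localComponent_pow_eq_one L χ hχu k w.1 u

/-- **THE SOCKET `hχu′`**: `‖χ′_w(u)‖ = 1` for `χ′_v := conjInvChar c v (fun w => (χ^k)_w)`, `χ` unitary. [cite: TateThesis1967, §4.3] [cite: HarrisKudlaSweet1996, §1 (1.15)] -/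
theorem hχu'_of_isUnitary (hχu : χ.IsUnitary) (k : ℕ) (v : HeightOneSpectrum (𝓞 (Fp L))) (w : PlacesOver L v) (u : (w.1.adicCompletion L)ˣ) :
    ‖((conjInvChar L (IsCMField.complexConj L) v (fun w : PlacesOver L v => (χ ^ k).localComponent w.1) w u : ℂˣ) : ℂ)‖ = 1 :=
  norm_conjInvChar_eq_one L (IsCMField.complexConj L) v _ (hχu_of_isUnitary L hχu k v) w u

end CM

/-! ## §3 The compact-open Levi subgroup `K₁ := U(𝔻)(𝒪_v) ∩ M_Δ` -/

section Levi

variable (L : Type) [Field L] [NumberField L] [IsCMField L]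
variable {N M n : ℕ} (e : Fin N × Fin M ≃ Fin n)
  (dV : Fin N → L) (hdV : ∀ i, IsCMField.complexConj L (dV i) = dV i)
  (dW : Fin M → L) (hdW : ∀ i, IsCMField.complexConj L (dW i) = dW i)
variable (v : HeightOneSpectrum (𝓞 (Fp L)))

/-- **a compact-open `K₀ ≤ H_v` cuts a compact-open subgroup `K₀ ∩ M_Δ` of the (closed, ★ I-4c) Siegel Levi `↥M_Δ`**.
[cite: PlatonovRapinchuk1994, §5.1] [cite: Kudla1994, §3] -/
theorem isCompact_isOpen_comap_leviDeltaLoc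
    (K₀ : Subgroup (UnitaryGroup.localPi L (IsCMField.complexConj L) (n + n) (hermD L e dV hdV dW hdW) v))
    (hK₀c : IsCompact (K₀ : Set (UnitaryGroup.localPi L (IsCMField.complexConj L) (n + n) (hermD L e dV hdV dW hdW) v)))
    (hK₀o : IsOpen (K₀ : Set (UnitaryGroup.localPi L (IsCMField.complexConj L) (n + n) (hermD L e dV hdV dW hdW) v))) :
    IsCompact ((K₀.comap (leviDeltaLoc L e dV hdV dW hdW v).subtype : Subgroup ↥(leviDeltaLoc L e dV hdV dW hdW v)) :
        Set ↥(leviDeltaLoc L e dV hdV dW hdW v)) ∧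
      IsOpen ((K₀.comap (leviDeltaLoc L e dV hdV dW hdW v).subtype : Subgroup ↥(leviDeltaLoc L e dV hdV dW hdW v)) :
        Set ↥(leviDeltaLoc L e dV hdV dW hdW v)) := by
  rw [Subgroup.coe_comap, Subgroup.coe_subtype]
  exact ⟨(isClosedEmbedding_subtype_leviDeltaLoc L e dV hdV dW hdW v).isCompact_preimage hK₀c, hK₀o.preimage continuous_subtype_val⟩

/-- **`K₁ := U(𝔻)(𝒪_v) ∩ M_Δ` IS COMPACT AND OPEN IN `↥M_Δ`** — the sockets `K₁`, `hK₁` of the face at the instance of record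
(`K₁ := (UnitaryGroup.localInt …).comap M_Δ.subtype`; ★ `isCompact_localInt`, ★ `isOpen_localInt`). [cite: PlatonovRapinchuk1994, §5.1] [cite: Kudla1994, §3] -/
theorem isCompact_isOpen_comap_localInt_leviDeltaLoc :
    IsCompact (((UnitaryGroup.localInt L (IsCMField.complexConj L) (n + n) (hermD L e dV hdV dW hdW) v).comap
        (leviDeltaLoc L e dV hdV dW hdW v).subtype : Subgroup ↥(leviDeltaLoc L e dV hdV dW hdW v)) : Set ↥(leviDeltaLoc L e dV hdV dW hdW v)) ∧
      IsOpen (((UnitaryGroup.localInt L (IsCMField.complexConj L) (n + n) (hermD L e dV hdV dW hdW) v).comap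
        (leviDeltaLoc L e dV hdV dW hdW v).subtype : Subgroup ↥(leviDeltaLoc L e dV hdV dW hdW v)) : Set ↥(leviDeltaLoc L e dV hdV dW hdW v)) :=
  isCompact_isOpen_comap_leviDeltaLoc L e dV hdV dW hdW v _
    (UnitaryGroup.isCompact_localInt L (IsCMField.complexConj L) (n + n) (hermD L e dV hdV dW hdW) v)
    (UnitaryGroup.isOpen_localInt L (IsCMField.complexConj L) (n + n) (hermD L e dV hdV dW hdW) v)

/-- hence the Siegel Levi `↥M_Δ` HAS a compact-open subgroup. [cite: PlatonovRapinchuk1994, §5.1] [cite: Kudla1994, §3] -/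
theorem exists_isCompact_isOpen_leviDeltaLoc :
    ∃ K₁ : Subgroup ↥(leviDeltaLoc L e dV hdV dW hdW v),
      IsCompact (K₁ : Set ↥(leviDeltaLoc L e dV hdV dW hdW v)) ∧ IsOpen (K₁ : Set ↥(leviDeltaLoc L e dV hdV dW hdW v)) :=
  ⟨_, isCompact_isOpen_comap_localInt_leviDeltaLoc L e dV hdV dW hdW v⟩

end Levi

end Summit.HodgeConjecture.HodgeConjecture.Cruxes.HLiu418.K2LiuA7ValueSocketLeviResidue

end
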